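import Summits.QuantumFields.YangMills.Theorems.UnitScaleTiltProp8FlatPortDistance
import Summits.QuantumFields.YangMills.Theorems.UnitScaleTiltProp8FlatPortChartL0
import Literature.MathematicalPhysics.QuantumFieldTheory.Balaban1983to89.B6Ineq2142KLevelV1L0
import Literature.MathematicalPhysics.QuantumFieldTheory.Balaban1983to89.B9Thm314GpFlatTorusGeometryL0
import HarnessLib

/-!
# Route `UnitScaleTilt`, crux K1 child «MinimiserStabilityRegPr» (stmt-QuantumFields-19200), v8 pillar **P2 `stub_flatOpsCubeSeq`** — THE PORT BRIDGE, file 2,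
# **LEVEL-0 TWIN** (GAP LIST v22 (P2-L0)): `distBI(b, c) ≤ d_T(y(b), β c) + 3` for lit-balaban's LEVEL-0-ADMITTING torus families
# `B6MultiLevelTorusOperatorL0.TDomains` (blocks of every level `0 ≤ j ≤ k`; the P2 text's `Adm22` families have unit cubes `Λ₀ ≠ ∅` in general, which the
# `V1` lineage (`B6MultiLevelTorusOperator.TDomains`, levels `≥ 1`) cannot chart — see `UnitScaleTiltProp8FlatPortChartL0`).

Cell `ym3-torus` (HUMAN RULING D-0037, YM ladder rung R3), seat `ym3-torus-p1` gen 18.  `--supports stmt-QuantumFields-19200 --as helper`; count-neutral; def-free.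
This file is `UnitScaleTiltProp8FlatPortDistance` (gen 17) with the level-0 dictionary substituted: `B6GlobalChartV1L0.{blkV1, domT, iterBlockOf_mem_domT_iff}`
(guard-free: no `1 ≤ j`), `B6Geom246MultiLevel{Box,Torus}L0`, `B6Ineq2142KLevelV1L0.{lvl, β, base, baseSite, ends_eq}`, `B9Thm314GpFlatTorusGeometryL0.dist_posT_le_mul_distT`;
the `D`-free lemmas (`FlatPortDistance.distSite_shift_le_one`, `B9Thm314GpFlatTorusGeometry.powL_mono_real`, `FlatPortChart.*`) are reused, not restated.

THE PRINT.  [Balaban1985Variational] (161) p. 303 line 3: *«|y₂ − y| ≤ d(y₁, y₂) + 3d²M_Δ»* — the physical distance is controlled by the multiscale distance (2.46) of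
[Balaban1984PropagatorsII] p. 231 (*«d(y, y′) = inf_Γ |Γ|, where Γ is a contour joining y and y′, built of admissible bonds, and |Γ| is the number of these bonds»*);
the P2 text states its decay letters over an abstract `dBI ≥ distBI` exactly so that the port's `d_T` can be plugged in (OWNER RULING g22-№1 §B1 option (β)).

WHAT IS PROVED (sorry-free; axioms standard), for lit-balaban's level-0 torus families `D : B6MultiLevelTorusOperatorL0.TDomains d ℓ M_h k P′ R` on `PV d ℓ m K` (`hN`):
* §1 **`torusSupNorm_le_of_blocks`** (two fine sites in blocks at graph distance `n` are within `(n + 1)·L^k − 1` in the torus sup-distance);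
* §2 **`levV_domT`** (the P2 level `j(x)` of `domT hN D hk` IS `D.lev (toBox x)` — now for ALL levels including `0`), `levOf_domT`, `blkV1_level`;
* §3 **`distBI_domT_le`**: `distBI (domT hN D hk) b c ≤ d_T(blkV1 b, β c) + 3` for every fine bond `b` and index bond `c` (`M_h ≥ 1`, `P′ ≥ 1`).
HONEST SCOPE: geometry/bookkeeping only; constants crude (`+3`); NOT a claim about the mass gap.

References: T. Bałaban, CMP **96** (1984) 223–250 [Balaban1984PropagatorsII] (2.1)–(2.4) p.224, (2.45)–(2.46) p.231; CMP **102** (1985) 277–309 [Balaban1985Variational] (161) p.303.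
-/

set_option autoImplicit false

noncomputable section

open scoped BigOperators

namespace Summit.QuantumFields.YangMills.Theorems.FlatPortDistanceL0

open Literature.MathematicalPhysics.QuantumFieldTheory.Balaban1983to89
open B4Reflection242 (boxDom mem_boxDom blk)
open B4TorusKernel.MultiPeriod (torusSupNorm)
open B5Eq117TorusCarriers (Mk)
open B5Eq118OneStroke (iterBlockOf)
open B5Prop12FieldsLattice (distSite distSite_self distSite_nonneg)
open B5RowSumsP12Lattice (distSite_comm distSite_triangle)
open B6MultiLevelBoxOperator (N0)
open B6MultiLevelTorusOperator (one_le_of_mem)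
open B6MultiLevelTorusOperatorL0 (TDomains)
open B6Geom246MultiLevelBox (toR)
open B6Geom246MultiLevelBoxL0 (bset blkOf scale_bounds)
open B6Geom246MultiLevelTorus (toT dist_toT_toR)
open B6Geom246MultiLevelTorusL0 (geomT bondT TouchT posT dist_site_posT_le)
open B6GlobalChartV1 (PV toBox toBox_apply)
open B6GlobalChartV1L0 (blkV1 domT iterBlockOf_mem_domT_iff)
open B6Ineq2142KLevelV1L0 (lvl lvl_le β base baseSite iterBlockOf_baseSite ends_eq)
open B6SectADomainsV1 (Domains)
open B6SectAOperatorsV1 (BondIdx)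
open B11Eq115Space (levOf)
open FlatCubeOpsText (distBI)
open FlatPortChart (levV le_levV_iff levV_le pow_mul_distSite_iterBlockOf_le distSite_zero_eq_torusSupNorm)
open FlatPortDistance (distSite_shift_le_one)

variable {d ℓ m K : ℕ} {hd : 1 ≤ d + 1} {hL : Odd (ℓ + 1) ∧ 1 < ℓ + 1}
variable {Mh k R : ℕ} {P' : Fin (d + 1) → ℕ}

/-! ## §1 Block centres along admissible chains; fine sites of blocks at graph distance `n` -/

section Walk

variable {D : TDomains d ℓ Mh k P' R}

/-- **TWO FINE SITES IN BLOCKS AT GRAPH DISTANCE `n` ARE WITHIN `(n + 1)·L^k − 1` IN THE TORUS SUP-DISTANCE** (print (161) line 3: «|y₂ − y| ≤ d(y₁, y₂) + …»).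
[cite: Balaban1985Variational, (161) p.303; Balaban1984PropagatorsII, (2.46) p.231] -/
theorem torusSupNorm_le_of_blocks (hMh : 1 ≤ Mh) (hP : ∀ μ, 1 ≤ P' μ) (x x' : ↥(boxDom (N0 ℓ Mh k P')))
    {s t : ↥(B6Geom246MultiLevelBoxL0.bset D.toDomains)} (hx : B6Geom246MultiLevelBoxL0.blkOf D.toDomains x = s)
    (hx' : B6Geom246MultiLevelBoxL0.blkOf D.toDomains x' = t) :
    torusSupNorm (N0 ℓ Mh k P') (x.1 - x'.1) ≤ (((B6Geom246MultiLevelTorusL0.bondT D).dist s t : ℕ) + 1 : ℝ) * (((ℓ + 1) ^ k : ℕ) : ℝ) - 1 := by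
  have hN1 : ∀ i, 1 ≤ N0 ℓ Mh k P' i := one_le_of_mem x.2
  have h1 := dist_site_posT_le (D := D) hx
  have h2 := dist_site_posT_le (D := D) hx'
  have hw : dist (posT D s) (posT D t) ≤ ((bondT D).dist s t : ℝ) * (((ℓ + 1) ^ k : ℕ) : ℝ) :=
    B9Thm314GpFlatTorusGeometryL0.dist_posT_le_mul_distT D hMh hP s t
  have hs := B9Thm314GpFlatTorusGeometry.powL_mono_real (ℓ := ℓ) (scale_bounds D.toDomains s).2
  have ht := B9Thm314GpFlatTorusGeometry.powL_mono_real (ℓ := ℓ) (scale_bounds D.toDomains t).2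
  rw [← dist_toT_toR hN1]
  rw [dist_comm] at h2
  calc dist (toT (N0 ℓ Mh k P') (toR x.1)) (toT (N0 ℓ Mh k P') (toR x'.1))
      ≤ dist (toT _ (toR x.1)) (posT D s) + dist (posT D s) (posT D t) + dist (posT D t) (toT _ (toR x'.1)) :=
        dist_triangle4 _ _ _ _
    _ ≤ ((((ℓ + 1) ^ s.1.1 : ℕ) : ℝ) - 1) / 2 + ((bondT D).dist s t : ℝ) * (((ℓ + 1) ^ k : ℕ) : ℝ) + ((((ℓ + 1) ^ t.1.1 : ℕ) : ℝ) - 1) / 2 := by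
        linarith
    _ ≤ (((bondT D).dist s t : ℕ) + 1 : ℝ) * (((ℓ + 1) ^ k : ℕ) : ℝ) - 1 := by linarith

end Walk

/-! ## §2 The P2 level function of `domT` is the lineage's level function -/

section Level

variable (hN : ∀ μ, N0 ℓ Mh k P' μ = (PV d ℓ m K hd hL).sitesPerDir 0) (D : TDomains d ℓ Mh k P' R) (hk : k ≤ m + K)

/-- **`j(x)` OF `domT hN D hk` IS `D.lev (toBox x)`**. [cite: Balaban1984PropagatorsII, (2.1)-(2.4) p.224] -/
theorem levV_domT (x : Site (PV d ℓ m K hd hL) 0) : levV (B6GlobalChartV1L0.domT hN D hk) x = D.lev (toBox hN x : Fin (d + 1) → ℤ) := by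
  have hle : D.lev (toBox hN x : Fin (d + 1) → ℤ) ≤ k := D.lev_le _
  refine le_antisymm ?_ ?_
  · -- `levV ≤ lev`: `x ∈ Ω_{levV}` and the (guard-free, level `0` admitted) dictionary
    have hjk : levV (domT hN D hk) x ≤ k := levV_le (domT hN D hk) x
    have hin := (le_levV_iff (domT hN D hk) (show levV (domT hN D hk) x ≤ (domT hN D hk).k from hjk) x).1 le_rfl
    exact (iterBlockOf_mem_domT_iff hN D hk hjk x).1 hin
  · have hin := (iterBlockOf_mem_domT_iff hN D hk hle x).2 le_rfl
    exact (le_levV_iff (domT hN D hk) (show D.lev (toBox hN x : Fin (d + 1) → ℤ) ≤ (domT hN D hk).k from hle) x).2 hin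

/-- the same for the raw `levOf` of the P2 text (`IsLevWeight`'s exponent). [cite: Balaban1985Variational, p.286, (115) p.294] -/
theorem levOf_domT (x : Site (PV d ℓ m K hd hL) 0) :
    levOf (fun j => {x : Site (PV d ℓ m K hd hL) 0 | (B6GlobalChartV1L0.domT hN D hk).InOm j x}) k x = D.lev (toBox hN x : Fin (d + 1) → ℤ) :=
  levV_domT hN D hk x

/-- the level of the block `blkV1 b` is `D.lev (toBox b₋)`. [cite: Balaban1984PropagatorsII, (2.45) p.231] -/
theorem blkV1_level (b : PBond (PV d ℓ m K hd hL) 0) : (B6GlobalChartV1L0.blkV1 hN D b).1.1 = D.lev (toBox hN b.src : Fin (d + 1) → ℤ) := rfl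

end Level

/-! ## §3 `distBI ≤ d_T + 3` -/

section Compare

variable (hN : ∀ μ, N0 ℓ Mh k P' μ = (PV d ℓ m K hd hL).sitesPerDir 0) (D : TDomains d ℓ Mh k P' R) (hk : k ≤ m + K)

/-- **THE COMPARATOR OF THE P2 TEXT FOR THE PORT'S DISTANCE**: `distBI (domT hN D hk) b c ≤ d_T(blkV1 b, β c) + 3` — the level-`j(c)` physical distance between
the `j(c)`-block of `b₋` and `c₋`, in `k`-units, against p21's multiscale graph distance (2.46) between the block of `b₋` and the carrier block of `c` (level-`0`
families; `M_h ≥ 1`, `P′ ≥ 1`). [cite: Balaban1985Variational, (161) p.303; Balaban1984PropagatorsII, (2.46) p.231] -/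
theorem distBI_domT_le (hMh : 1 ≤ Mh) (hP : ∀ μ, 1 ≤ P' μ) (b : PBond (PV d ℓ m K hd hL) 0) (c : BondIdx (B6GlobalChartV1L0.domT hN D hk)) :
    distBI (B6GlobalChartV1L0.domT hN D hk) b c ≤
      ((B6Geom246MultiLevelTorusL0.bondT D).dist (B6GlobalChartV1L0.blkV1 hN D b) (B6Ineq2142KLevelV1L0.β hN D hk c) : ℝ) + 3 := by
  -- notation
  set j : ℕ := (c.1.1 : ℕ) with hj
  have hjk : j ≤ k := lvl_le hN D hk c
  have hjmK : j ≤ m + K := hjk.trans hk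
  set x : Site (PV d ℓ m K hd hL) 0 := b.src with hx
  set xc : Site (PV d ℓ m K hd hL) 0 := baseSite hN D hk c with hxc
  set n : ℕ := (bondT D).dist (blkV1 hN D b) (β hN D hk c) with hn
  set Lr : ℝ := ((ℓ + 1 : ℕ) : ℝ) with hLr
  have hL1 : (1 : ℝ) ≤ Lr := by rw [hLr]; exact_mod_cast Nat.succ_pos ℓ
  have hL0 : (0 : ℝ) < Lr := lt_of_lt_of_le zero_lt_one hL1
  have hLP : ((PV d ℓ m K hd hL).L : ℝ) = Lr := rfl
  -- (i) `L^j·dist_j(B^j x, base c) ≤ dist₀(x, x_c) + L^j − 1`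
  have hjPV : j ≤ (PV d ℓ m K hd hL).m + (PV d ℓ m K hd hL).K := hjmK
  have hup := pow_mul_distSite_iterBlockOf_le (P := PV d ℓ m K hd hL) j hjPV x xc
  rw [hLP] at hup
  have hbase : iterBlockOf j xc = base hN D hk c := iterBlockOf_baseSite hN D hk c
  rw [hbase] at hup
  -- (ii) `dist_j(base c, c₋) ≤ 1`
  have hb1 : distSite (Mk (PV d ℓ m K hd hL) j) (base hN D hk c) c.1.2.src ≤ 1 := by
    rcases ends_eq hN D hk c with ⟨h, -⟩ | ⟨h, -⟩
    · rw [h, distSite_self]; exact zero_le_one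
    · rw [h]
      exact distSite_shift_le_one (P := PV d ℓ m K hd hL) c.1.2.src c.1.2.dir
  have htri := distSite_triangle (Mk (PV d ℓ m K hd hL) j) (iterBlockOf j x) (base hN D hk c) c.1.2.src
  -- (iii) `dist₀(x, x_c) ≤ (n + 1)·L^k − 1`
  have hd0 : distSite (Mk (PV d ℓ m K hd hL) 0) x xc ≤ ((n : ℕ) + 1 : ℝ) * (((ℓ + 1) ^ k : ℕ) : ℝ) - 1 := by
    rw [distSite_zero_eq_torusSupNorm hN]
    have := torusSupNorm_le_of_blocks (D := D) hMh hP (toBox hN x) (toBox hN xc) (s := blkV1 hN D b) (t := β hN D hk c) rfl rfl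
    simpa [hn] using this
  -- (iv) assemble: `L^j·dist_j(B^j x, c₋) ≤ (n + 3)·L^k`
  have hLj : (1 : ℝ) ≤ Lr ^ j := one_le_pow₀ hL1
  have hLjk : Lr ^ j ≤ Lr ^ k := pow_le_pow_right₀ hL1 hjk
  have hcastk : (((ℓ + 1) ^ k : ℕ) : ℝ) = Lr ^ k := by rw [hLr]; push_cast; ring
  rw [hcastk] at hd0
  have hmain : Lr ^ j * distSite (Mk (PV d ℓ m K hd hL) j) (iterBlockOf j x) c.1.2.src ≤ ((n : ℝ) + 3) * Lr ^ k := by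
    have h1 : Lr ^ j * distSite (Mk (PV d ℓ m K hd hL) j) (iterBlockOf j x) c.1.2.src ≤
        Lr ^ j * distSite (Mk (PV d ℓ m K hd hL) j) (iterBlockOf j x) (base hN D hk c) + Lr ^ j * 1 := by
      rw [← mul_add]
      exact mul_le_mul_of_nonneg_left (htri.trans (add_le_add le_rfl hb1)) (by positivity)
    linarith [h1, hup, hd0, hLj, hLjk, distSite_nonneg x xc]
  -- (v) `distBI = L^{−(k−j)}·dist_j`
  have hdef : distBI (domT hN D hk) b c = (Lr⁻¹) ^ (k - j) * distSite (Mk (PV d ℓ m K hd hL) j) (iterBlockOf j x) c.1.2.src := rfl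
  rw [hdef]
  have hsplit : Lr ^ k = Lr ^ j * Lr ^ (k - j) := by rw [← pow_add]; congr 1; omega
  have hpos : (0 : ℝ) < Lr ^ (k - j) := pow_pos hL0 _
  rw [inv_pow, inv_mul_le_iff₀ hpos]
  have : Lr ^ j * distSite (Mk (PV d ℓ m K hd hL) j) (iterBlockOf j x) c.1.2.src ≤ Lr ^ j * (Lr ^ (k - j) * (((n : ℝ)) + 3)) := by
    calc _ ≤ ((n : ℝ) + 3) * Lr ^ k := hmain
      _ = Lr ^ j * (Lr ^ (k - j) * ((n : ℝ) + 3)) := by rw [hsplit]; ring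
  exact le_of_mul_le_mul_left this (pow_pos hL0 j)

end Compare

end Summit.QuantumFields.YangMills.Theorems.FlatPortDistanceL0

end
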